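import Literature.NumberTheory.ComplexMultiplication.EllipticUnits.DivisionPointsIndex
import Literature.NumberTheory.ComplexMultiplication.EllipticUnits.KatoUnitRepIndependence
import HarnessLib

/-!
# de Shalit II.2.4 (ii), SECOND CLAUSE, as a THEOREM: the composition formula
# `Θ(v; 𝔠⁻¹L, 𝔞) · Θ(v; L, 𝔠)^{N𝔞} = Θ(v; L, 𝔞𝔠)`

Topic `NumberTheory/ComplexMultiplication/EllipticUnits`; namespace
`Literature.NumberTheory.ComplexMultiplication.EllipticUnits` (analytic lemmas as dot-notation extensions of
Mathlib's `PeriodPair`). Cell `bsd-print-cf2` (`run/shared/lean/pub/bsd-print-cf2/`), width seat `bsd-line-cf2-p1-w5` g19,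
`--supports` crux stmt-BirchSwinnertonDyer-20368, whose registered skeleton carries the named fact
`DeShalit1987.prop24_ii_galoisAction` (pure-cite stubs S0‴ and S0⁗). THEOREMS ONLY (no `def`, no named fact, no instance,
no `sorry`); UNCONDITIONAL.

PRINT. de Shalit, *Iwasawa theory of elliptic curves with complex multiplication* (1987), II.2.4 Proposition (ii):
"`Θ(v; L, 𝔞)^{σ_𝔠} = Θ(v; 𝔠⁻¹L, 𝔞) = Θ(v; L, 𝔞𝔠)·Θ(v; L, 𝔠)^{−N𝔞}`". The tree types it as the named fact
`DeShalit1987.prop24_ii_galoisAction = (a) ∧ (b)`: (a) the Galois action `ι̂(σ_𝔠 x) = Θ(v; 𝔠⁻¹L, 𝔞)` (Shimura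
reciprocity — deep), and (b) the identity `Θ(v; 𝔠⁻¹L, 𝔞) · Θ(v; L, 𝔠)^{N𝔞} = Θ(v; L, 𝔞𝔠)` between COMPLEX NUMBERS. With
de Shalit's definition through the `σ`-function, `Θ(z; L, 𝔞) = θ(z, L)^{N𝔞}/θ(z, 𝔞⁻¹L)` (II.2.3 (10), first form),
(b) is a telescoping triviality; the tree defines `Θ` by the PRODUCT form of (10)
(`PeriodPair.deShalitTheta L La S z = Δ(L)/Δ(La) · Δ(L)^{#S−1} ∏_{u ∈ S∖0} (℘(z;L) − ℘(u;L))⁻⁶`), for which (b) is a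
genuine identity of elliptic functions. THIS FILE PROVES (b) in that currency, for every `z ∉ (𝔞𝔠)⁻¹Λ`.

METHOD (Rubin, LNM 1716, Thm. 7.13 at `k = 1`, the tree's `PeriodPair.logDeriv_ellipticTheta`: `Θ′/Θ(z; Λ, S) =
12(#S·E₁(z; Λ) − E₁(z; Λ′))` for `S` representing `Λ′/Λ`): the logarithmic derivatives of the two sides of (b)
TELESCOPE — `12(N𝔞 E₁(𝔠⁻¹Λ) − E₁((𝔞𝔠)⁻¹Λ)) + N𝔞·12(N𝔠 E₁(Λ) − E₁(𝔠⁻¹Λ)) = 12(N𝔞N𝔠 E₁(Λ) − E₁((𝔞𝔠)⁻¹Λ))` — with NO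
distribution relation needed; two nowhere-vanishing holomorphic functions on the connected open set `ℂ ∖ (𝔞𝔠)⁻¹Λ` with
the same logarithmic derivative are proportional (`PeriodPair.exists_eq_const_mul_of_logDeriv_eq`); the constant is read
off at `z → 0`, where `z²℘(z) → 1` (Mathlib's `PeriodPair.weierstrassPExcept`) gives
`Θ(z; Λ, S) ∼ Δ(Λ)^{#S−1} z^{12(#S−1)}`; finally `#S = N𝔞`, `#U = N(𝔞𝔠) = N𝔞·N𝔠`
(`PeriodPair.IsLatticeReps.card_eq_absNorm`) and the `Δ`-prefactors of `deShalitTheta` recombine to `Δ(L)/Δ((𝔞𝔠)⁻¹L)`.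

WHAT IS PROVED: §1 `PeriodPair.tendsto_sq_mul_weierstrassP_sub` (`z²(℘(z) − x) → 1`),
`PeriodPair.tendsto_ellipticTheta_div_pow` (leading term of `Θ` at `0`); §2 ★ `PeriodPair.ellipticTheta_mul_pow_eq`
(pure lattices `Λ ≤ Λ_c ≤ Λ_{ca}` with representatives `T`, `Sc`, `U` and `#U = #Sc·#T`: `Θ(z; Λ_c, Sc)·Θ(z; Λ, T)^{#Sc}
= (Δ(Λ_c)/Δ(Λ))^{#Sc−1} · Θ(z; Λ, U)` off `Λ_{ca}`); §3 ★★ `DeShalit1987.prop24_ii_clause_b` — clause (b) of the named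
fact with the fact's own binders (those it needs), conclusion VERBATIM:
`Lc.deShalitTheta Lca Sc v * L.deShalitTheta Lc T v ^ S.card = L.deShalitTheta Lac U v`.
HONEST FRAMING: clause (a) (the Galois action) is untouched — it is the CM content; nothing here is about an elliptic
curve over `ℚ`; no summit statement is proved; BSD is not advanced.
presearch: composition / "cocycle" formula for Θ(z; L, 𝔞) in product form → [corpus: deShalit1987 II.2.4 (ii) p. 44–45
(store `book:shalit1987-…` chunk p0045)] proof via Θ = θ^{N𝔞}/θ(·, 𝔞⁻¹L); [corpus: Rubin LNM 1716 Thm 7.13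
(`book:coates1999-arithmetic-theory-elliptic-curves` p. 244)] the log-derivative formula used here; tree: conditional uses
only (`h24ii … .2`, e.g. `PrintCf2RubinValueTwoEllipticUnitsLocalRelation`); no unconditional statement (`lean search`).

## References
* [deShalit1987] E. de Shalit, *Iwasawa theory of elliptic curves with complex multiplication* (1987), II.2.3 (10),
  II.2.4 Proposition (ii).
* [Rubin1999] K. Rubin, *Elliptic curves with complex multiplication and the conjecture of Birch and Swinnerton-Dyer*,
  LNM 1716 (1999), §7.4 Thm. 7.13.
* [Silverman1994] J. Silverman, *Advanced Topics in the Arithmetic of Elliptic Curves* (1994), Ch. II §1.1 Cor. 1.5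
  (`#(𝔞⁻¹L/L) = N𝔞`).
-/

noncomputable section

open scoped Classical
open Complex Set Filter Topology
open NumberField IsDedekindDomain

/-! ## §1. Leading terms at `z = 0` -/

namespace PeriodPair

variable (L : PeriodPair)

/-- **`z²(℘(z; Λ) − x) → 1` as `z → 0`, `z ≠ 0`** (the double pole of `℘` at the origin with leading coefficient `1`:
`℘(z) = 1/z² + ℘^{exc}_0(z)` with `℘^{exc}_0` holomorphic at `0` and vanishing there — Mathlib's `weierstrassPExcept`).
[cite: Rubin1999, §7.4 (p. 244)] -/
theorem tendsto_sq_mul_weierstrassP_sub (x : ℂ) :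
    Tendsto (fun z ↦ z ^ 2 * (℘[L] z - x)) (𝓝[≠] 0) (𝓝 1) := by
  have h0 : (0 : ℂ) ∈ L.lattice := zero_mem _
  -- `℘[L - 0]` is continuous at `0` with value `0`
  have hopen : IsOpen ((L.lattice : Set ℂ) \ {0})ᶜ := L.isOpen_compl_lattice_sdiff
  have hcont : ContinuousAt (L.weierstrassPExcept 0) 0 :=
    ((L.differentiableOn_weierstrassPExcept 0).differentiableAt
      (hopen.mem_nhds (show (0 : ℂ) ∈ ((L.lattice : Set ℂ) \ {0})ᶜ by simp))).continuousAt
  have h1 : Tendsto (fun z ↦ z ^ 2 * L.weierstrassPExcept 0 z + 1 - z ^ 2 * x) (𝓝[≠] 0) (𝓝 1) := by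
    have hA : Tendsto (fun z : ℂ ↦ z ^ 2 * L.weierstrassPExcept 0 z) (𝓝 0) (𝓝 0) := by
      have := ((continuous_pow 2).continuousAt (x := (0 : ℂ))).tendsto.mul hcont.tendsto
      simpa using this
    have hB : Tendsto (fun z : ℂ ↦ z ^ 2 * x) (𝓝 0) (𝓝 0) := by
      have := ((continuous_pow 2).continuousAt (x := (0 : ℂ))).tendsto.mul_const x
      simpa using this
    have hC : Tendsto (fun z ↦ z ^ 2 * L.weierstrassPExcept 0 z + 1 - z ^ 2 * x) (𝓝 0)
        (𝓝 (0 + 1 - 0)) := (hA.add_const 1).sub hB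
    rw [zero_add, sub_zero] at hC
    exact tendsto_nhdsWithin_of_tendsto_nhds hC
  refine h1.congr' ?_
  filter_upwards [self_mem_nhdsWithin] with z hz
  have hz' : z ≠ 0 := hz
  have e : ℘[L] z = L.weierstrassPExcept 0 z + (z ^ 2)⁻¹ := by
    have h := L.weierstrassPExcept_add ⟨0, h0⟩ z
    simp only [sub_zero, ne_eq, OfNat.ofNat_ne_zero, not_false_eq_true, zero_pow, div_zero,
      one_div] at h
    exact h.symm
  rw [e, mul_sub, mul_add, mul_inv_cancel₀ (pow_ne_zero 2 hz')]

/-- **Leading term of `Θ(z; Λ, S)` at `z = 0`**: for `S ∋ 0`, `Θ(z; Λ, S) / z^{12(#S−1)} → Δ(Λ)^{#S−1}` as `z → 0`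
(`z ≠ 0`) — each of the `#S − 1` factors `(℘(z) − ℘(c))⁻⁶` is `z^{12}·(z²(℘(z) − ℘(c)))⁻⁶` with
`z²(℘(z) − ℘(c)) → 1`. [cite: Rubin1999, §7.4 (p. 244)] -/
theorem tendsto_ellipticTheta_div_pow {S : Finset ℂ} (hS0 : (0 : ℂ) ∈ S) :
    Tendsto (fun z ↦ L.ellipticTheta S z / z ^ (12 * (S.card - 1))) (𝓝[≠] 0)
      (𝓝 ((L.g₂ ^ 3 - 27 * L.g₃ ^ 2) ^ (S.card - 1))) := by
  have hcard : (S.erase 0).card = S.card - 1 := Finset.card_erase_of_mem hS0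
  -- off `0`, rewrite the quotient as `Δ^{#S−1} · ∏ (z²(℘ z − ℘ c))⁻⁶`
  have key : ∀ z : ℂ, z ≠ 0 → L.ellipticTheta S z / z ^ (12 * (S.card - 1)) =
      (L.g₂ ^ 3 - 27 * L.g₃ ^ 2) ^ (S.card - 1) *
        ∏ c ∈ S.erase 0, (z ^ 2 * (℘[L] z - ℘[L] c)) ^ (-6 : ℤ) := by
    intro z hz
    rw [ellipticTheta_def, mul_div_assoc]
    congr 1
    have hz12 : z ^ (12 * (S.card - 1)) = ∏ _c ∈ S.erase 0, z ^ 12 := by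
      rw [Finset.prod_const, hcard, ← pow_mul]
    rw [hz12, ← Finset.prod_div_distrib]
    refine Finset.prod_congr rfl fun c _ ↦ ?_
    rw [mul_zpow]
    simp only [zpow_neg, zpow_ofNat]
    rw [← pow_mul, show 2 * 6 = 12 from rfl, div_eq_mul_inv, mul_comm]
  have hlim : Tendsto (fun z ↦ (L.g₂ ^ 3 - 27 * L.g₃ ^ 2) ^ (S.card - 1) *
      ∏ c ∈ S.erase 0, (z ^ 2 * (℘[L] z - ℘[L] c)) ^ (-6 : ℤ)) (𝓝[≠] 0)
      (𝓝 ((L.g₂ ^ 3 - 27 * L.g₃ ^ 2) ^ (S.card - 1) * ∏ c ∈ S.erase 0, (1 : ℂ) ^ (-6 : ℤ))) := by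
    refine Tendsto.const_mul _ (tendsto_finsetProd _ fun c _ ↦ ?_)
    exact (L.tendsto_sq_mul_weierstrassP_sub (℘[L] c)).zpow₀ (-6) (Or.inl one_ne_zero)
  simp only [one_zpow, Finset.prod_const_one, mul_one] at hlim
  refine hlim.congr' ?_
  filter_upwards [self_mem_nhdsWithin] with z hz
  exact (key z hz).symm

/-- Off `0` near `0`, a point avoids any period lattice (lattices are discrete and closed). [folklore] -/
private theorem eventually_nhdsWithin_ne_notMem_lattice :
    ∀ᶠ z in 𝓝[≠] (0 : ℂ), z ∉ L.lattice := by
  have hopen : IsOpen ((L.lattice : Set ℂ) \ {0})ᶜ := L.isOpen_compl_lattice_sdiff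
  have hmem : ((L.lattice : Set ℂ) \ {0})ᶜ ∈ 𝓝 (0 : ℂ) :=
    hopen.mem_nhds (show (0 : ℂ) ∈ ((L.lattice : Set ℂ) \ {0})ᶜ by simp)
  filter_upwards [mem_nhdsWithin_of_mem_nhds hmem, self_mem_nhdsWithin] with z hz hz0
  intro hzL
  exact hz ⟨hzL, hz0⟩

/-! ## §2. The composition formula for `Θ(z; Λ, S)` (pure lattices) -/

variable {L}

/-- **Composition formula for Rubin's `Θ`, with the explicit constant.** For period lattices `Λ ≤ Λ_c ≤ Λ_{ca}`
(period pairs `L`, `Lc`, `Lca`) with systems of representatives `T ∋ 0` of `Λ_c/Λ`, `Sc ∋ 0` of `Λ_{ca}/Λ_c` and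
`U ∋ 0` of `Λ_{ca}/Λ`, and `#U = #Sc · #T` (index multiplicativity, supplied by the caller), for every
`z ∉ Λ_{ca}`:

  `Θ(z; Λ_c, Sc) · Θ(z; Λ, T)^{#Sc} = (Δ(Λ_c)/Δ(Λ))^{#Sc − 1} · Θ(z; Λ, U)`.

Both sides are nowhere-vanishing holomorphic functions on the connected open set `ℂ ∖ Λ_{ca}` with the SAME logarithmic
derivative `12(#Sc#T·E₁(z;Λ) − E₁(z;Λ_{ca}))` (Rubin Thm. 7.13 three times; the middle terms `E₁(z; Λ_c)` cancel), hence
proportional; the constant is the ratio of the leading coefficients at `z = 0`,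
`Δ(Λ_c)^{#Sc−1}·Δ(Λ)^{#Sc(#T−1)} / Δ(Λ)^{#Sc#T−1} = (Δ(Λ_c)/Δ(Λ))^{#Sc−1}`.
[cite: deShalit1987, II.2.4 Proposition (ii)] [cite: Rubin1999, §7.4 Thm. 7.13] -/
theorem ellipticTheta_mul_pow_eq {Lc Lca : PeriodPair} {T Sc U : Finset ℂ} (hT : L.IsLatticeReps Lc T)
    (hSc : Lc.IsLatticeReps Lca Sc) (hU : L.IsLatticeReps Lca U) (hcard : U.card = Sc.card * T.card)
    {z : ℂ} (hz : z ∉ Lca.lattice) :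
    Lc.ellipticTheta Sc z * L.ellipticTheta T z ^ Sc.card =
      ((Lc.g₂ ^ 3 - 27 * Lc.g₃ ^ 2) / (L.g₂ ^ 3 - 27 * L.g₃ ^ 2)) ^ (Sc.card - 1) * L.ellipticTheta U z := by
  have hΔ0 : L.g₂ ^ 3 - 27 * L.g₃ ^ 2 ≠ 0 := L.discr_ne_zero
  have hn1 : 1 ≤ Sc.card := Finset.card_pos.mpr ⟨0, hSc.zero_mem⟩
  have hm1 : 1 ≤ T.card := Finset.card_pos.mpr ⟨0, hT.zero_mem⟩
  have hU1 : 1 ≤ U.card := Finset.card_pos.mpr ⟨0, hU.zero_mem⟩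
  have hcle : Lc.lattice ≤ Lca.lattice := hSc.le
  -- the open connected set `ℂ ∖ Λ_{ca}`
  set V : Set ℂ := (Lca.lattice : Set ℂ)ᶜ with hV
  have hVo : IsOpen V := Lca.isClosed_lattice.isOpen_compl
  have hcount : (Lca.lattice : Set ℂ).Countable := countable_of_Lindelof_of_discrete (X := Lca.lattice)
  have hVc : IsPreconnected V :=
    (hcount.isPathConnected_compl_of_one_lt_rank (by simp [Complex.rank_real_complex])).isConnected.isPreconnected
  -- pointwise facts on `V`
  have hdSc : ∀ w ∈ V, DifferentiableAt ℂ (Lc.ellipticTheta Sc) w := fun w hw ↦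
    differentiableAt_ellipticTheta hSc.mem_iff hSc.zero_mem hSc.distinct hw
  have hdT : ∀ w ∈ V, DifferentiableAt ℂ (L.ellipticTheta T) w := fun w hw ↦
    differentiableAt_ellipticTheta hT.mem_iff hT.zero_mem hT.distinct fun h ↦ hw (hcle h)
  have hdU : ∀ w ∈ V, DifferentiableAt ℂ (L.ellipticTheta U) w := fun w hw ↦
    differentiableAt_ellipticTheta hU.mem_iff hU.zero_mem hU.distinct hw
  have h0Sc : ∀ w ∈ V, Lc.ellipticTheta Sc w ≠ 0 := fun w hw ↦
    ellipticTheta_ne_zero hSc.mem_iff hSc.zero_mem hSc.distinct hw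
  have h0T : ∀ w ∈ V, L.ellipticTheta T w ≠ 0 := fun w hw ↦
    ellipticTheta_ne_zero hT.mem_iff hT.zero_mem hT.distinct fun h ↦ hw (hcle h)
  have h0U : ∀ w ∈ V, L.ellipticTheta U w ≠ 0 := fun w hw ↦
    ellipticTheta_ne_zero hU.mem_iff hU.zero_mem hU.distinct hw
  have hfd : ∀ w ∈ V, DifferentiableAt ℂ (fun w ↦ Lc.ellipticTheta Sc w * L.ellipticTheta T w ^ Sc.card) w :=
    fun w hw ↦ (hdSc w hw).mul ((hdT w hw).pow _)
  have hf0 : ∀ w ∈ V, Lc.ellipticTheta Sc w * L.ellipticTheta T w ^ Sc.card ≠ 0 :=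
    fun w hw ↦ mul_ne_zero (h0Sc w hw) (pow_ne_zero _ (h0T w hw))
  -- equality of logarithmic derivatives: the `E₁(·; Λ_c)` terms telescope
  have hlog : ∀ w ∈ V, logDeriv (fun w ↦ Lc.ellipticTheta Sc w * L.ellipticTheta T w ^ Sc.card) w =
      logDeriv (L.ellipticTheta U) w := by
    intro w hw
    have hwc : w ∉ Lc.lattice := fun h ↦ hw (hcle h)
    rw [logDeriv_mul (f := Lc.ellipticTheta Sc) (g := fun y ↦ L.ellipticTheta T y ^ Sc.card) w (h0Sc w hw)
        (pow_ne_zero _ (h0T w hw)) (hdSc w hw) ((hdT w hw).pow _),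
      logDeriv_fun_pow (hdT w hw), logDeriv_ellipticTheta hSc.mem_iff hSc.zero_mem hSc.distinct hw,
      logDeriv_ellipticTheta hT.mem_iff hT.zero_mem hT.distinct hwc,
      logDeriv_ellipticTheta hU.mem_iff hU.zero_mem hU.distinct hw, hcard]
    push_cast
    ring
  obtain ⟨c, hc0, hc⟩ := exists_eq_const_mul_of_logDeriv_eq hVo hVc hfd hdU hf0 h0U hlog
  have hc' : ∀ w ∈ V, Lc.ellipticTheta Sc w * L.ellipticTheta T w ^ Sc.card = c * L.ellipticTheta U w :=
    fun w hw ↦ by simpa using hc w hw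
  -- determine `c` from the leading terms at `0`
  have hcardZ : (U.card : ℤ) = Sc.card * T.card := by exact_mod_cast hcard
  have hexp : 12 * (U.card - 1) = 12 * (Sc.card - 1) + (12 * (T.card - 1)) * Sc.card := by
    zify [hU1, hn1, hm1]
    rw [hcardZ]
    ring
  have hlimf : Tendsto (fun w ↦ Lc.ellipticTheta Sc w * L.ellipticTheta T w ^ Sc.card / w ^ (12 * (U.card - 1)))
      (𝓝[≠] 0) (𝓝 ((Lc.g₂ ^ 3 - 27 * Lc.g₃ ^ 2) ^ (Sc.card - 1) *
        ((L.g₂ ^ 3 - 27 * L.g₃ ^ 2) ^ (T.card - 1)) ^ Sc.card)) := by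
    have hA := Lc.tendsto_ellipticTheta_div_pow hSc.zero_mem
    have hB := (L.tendsto_ellipticTheta_div_pow hT.zero_mem).pow Sc.card
    refine (hA.mul hB).congr' ?_
    filter_upwards [self_mem_nhdsWithin] with w hw
    have hw' : (w : ℂ) ≠ 0 := hw
    rw [hexp, pow_add, pow_mul w (12 * (T.card - 1)) Sc.card, div_pow]
    field_simp
  have hlimg : Tendsto (fun w ↦ L.ellipticTheta U w / w ^ (12 * (U.card - 1))) (𝓝[≠] 0)
      (𝓝 ((L.g₂ ^ 3 - 27 * L.g₃ ^ 2) ^ (U.card - 1))) :=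
    L.tendsto_ellipticTheta_div_pow hU.zero_mem
  have hlimcg : Tendsto (fun w ↦ Lc.ellipticTheta Sc w * L.ellipticTheta T w ^ Sc.card / w ^ (12 * (U.card - 1)))
      (𝓝[≠] 0) (𝓝 (c * (L.g₂ ^ 3 - 27 * L.g₃ ^ 2) ^ (U.card - 1))) := by
    refine (hlimg.const_mul c).congr' ?_
    filter_upwards [Lca.eventually_nhdsWithin_ne_notMem_lattice] with w hw
    rw [hc' w hw, mul_div_assoc]
  have hcval := tendsto_nhds_unique hlimf hlimcg
  -- solve for `c`
  have hpow : (L.g₂ ^ 3 - 27 * L.g₃ ^ 2) ^ (U.card - 1) =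
      (L.g₂ ^ 3 - 27 * L.g₃ ^ 2) ^ (Sc.card - 1) * ((L.g₂ ^ 3 - 27 * L.g₃ ^ 2) ^ (T.card - 1)) ^ Sc.card := by
    rw [← pow_mul, ← pow_add]
    congr 1
    zify [hU1, hn1, hm1]
    rw [hcardZ]
    ring
  rw [hpow, ← mul_assoc] at hcval
  have hc_eq : (Lc.g₂ ^ 3 - 27 * Lc.g₃ ^ 2) ^ (Sc.card - 1) = c * (L.g₂ ^ 3 - 27 * L.g₃ ^ 2) ^ (Sc.card - 1) :=
    mul_right_cancel₀ (pow_ne_zero _ (pow_ne_zero _ hΔ0)) hcval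
  rw [hc' z hz, div_pow, hc_eq, mul_div_assoc, div_self (pow_ne_zero _ hΔ0), mul_one]

end PeriodPair

/-! ## §3. de Shalit II.2.4 (ii), clause (b), in the fact's binders -/

namespace Literature.NumberTheory.ComplexMultiplication.EllipticUnits

open Literature.NumberTheory.EllipticCurves (IsImaginaryQuadratic)
open Literature.NumberTheory.NumberFields (rayClassField)
open Literature.NumberTheory.GaloisRepresentations (galFrob)
open Literature.NumberTheory.LFunctions.AbelianDensity (artinSymbol)

variable {K : Type} [Field K] [NumberField K]

omit [NumberField K] in
/-- A primitive `𝔪`-division point of `Λ` does not lie in `𝔟⁻¹Λ` for `𝔟` coprime to `𝔪 ≠ 𝒪_K` (its annihilator is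
exactly `𝔪`, and `𝔟 ≤ 𝔪` with `𝔟 + 𝔪 = 1` would force `𝔪 = 1`); hence `Θ(v; L, 𝔟) ≠ 0` and `v` is off the poles.
[cite: deShalit1987, II.2.4 Proposition] -/
theorem IsPrimitiveDivisionPoint.notMem_idealInvLattice_of_isCoprime {ι : K →+* ℂ} {𝔪 𝔟 : Ideal (𝓞 K)}
    {Λ : Submodule ℤ ℂ} {v : ℂ} (hv : IsPrimitiveDivisionPoint ι 𝔪 Λ v) (h𝔪 : 𝔪 ≠ ⊤) (h𝔟 : IsCoprime 𝔟 𝔪) :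
    v ∉ idealInvLattice ι 𝔟 Λ := by
  intro hmem
  have hle : 𝔟 ≤ 𝔪 := fun b hb ↦ (hv b).mp (mem_idealInvLattice_iff.mp hmem b hb)
  apply h𝔪
  rw [← Ideal.isCoprime_iff_sup_eq.mp h𝔟]
  exact le_antisymm le_sup_right (sup_le hle le_rfl)

/-- ★★ **de Shalit II.2.4 (ii), second clause — `Θ(v; 𝔠⁻¹L, 𝔞) · Θ(v; L, 𝔠)^{N𝔞} = Θ(v; L, 𝔞𝔠)` — PROVED.**
Exactly the binders of `DeShalit1987.prop24_ii_galoisAction` that the clause involves (`K` imaginary quadratic,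
`ι : K → ℂ`, `Λ` with `𝒪_K`-multiplication, `𝔪 ≠ 𝒪_K`, `v` a primitive `𝔪`-division point, `𝔞, 𝔠 ≠ 0` prime to `𝔪`,
period pairs `La`, `Lc`, `Lca`, `Lac` of lattices `𝔞⁻¹Λ`, `𝔠⁻¹Λ`, `𝔞⁻¹(𝔠⁻¹Λ)`, `(𝔞𝔠)⁻¹Λ` with representatives
`S`, `T`, `Sc`, `U`) and its conclusion VERBATIM:
`Lc.deShalitTheta Lca Sc v * L.deShalitTheta Lc T v ^ S.card = L.deShalitTheta Lac U v`.
(From `PeriodPair.ellipticTheta_mul_pow_eq` with `#S = #Sc = N𝔞`, `#T = N𝔠`, `#U = N(𝔞𝔠)`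
(`IsLatticeReps.card_eq_absNorm`), `𝔞⁻¹(𝔠⁻¹Λ) = (𝔞𝔠)⁻¹Λ`, and the `Δ`-prefactors
`Δ(Lc)/Δ(Lca) · (Δ(L)/Δ(Lc))^{N𝔞} · (Δ(Lc)/Δ(L))^{N𝔞−1} = Δ(L)/Δ(Lac)`.) The binders `𝔪 ≠ ⊥` and `hK` of the fact
are used only through `card_eq_absNorm`; the Galois clause (a) is NOT touched.
[cite: deShalit1987, II.2.4 Proposition (ii)] [cite: Rubin1999, §7.4 Thm. 7.13] [cite: Silverman1994, Ch. II §1.1 Cor. 1.5] -/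
theorem DeShalit1987.prop24_ii_clause_b (hK : IsImaginaryQuadratic K) (ι : K →+* ℂ)
    {L La Lc Lca Lac : PeriodPair} {S Sc T U : Finset ℂ} {𝔪 𝔞 𝔠 : Ideal (𝓞 K)} {v : ℂ}
    (hL : IsCMLattice ι L.lattice) (h𝔪 : 𝔪 ≠ ⊤) (hv : IsPrimitiveDivisionPoint ι 𝔪 L.lattice v)
    (h𝔞0 : 𝔞 ≠ ⊥) (h𝔞 : IsCoprime 𝔞 𝔪) (h𝔠0 : 𝔠 ≠ ⊥) (h𝔠 : IsCoprime 𝔠 𝔪)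
    (hLa : La.lattice = idealInvLattice ι 𝔞 L.lattice) (hS : L.IsLatticeReps La S)
    (hLc : Lc.lattice = idealInvLattice ι 𝔠 L.lattice) (hT : L.IsLatticeReps Lc T)
    (hLca : Lca.lattice = idealInvLattice ι 𝔞 Lc.lattice) (hSc : Lc.IsLatticeReps Lca Sc)
    (hLac : Lac.lattice = idealInvLattice ι (𝔞 * 𝔠) L.lattice) (hU : L.IsLatticeReps Lac U) :
    Lc.deShalitTheta Lca Sc v * L.deShalitTheta Lc T v ^ S.card = L.deShalitTheta Lac U v := by
  -- lattice bookkeeping: `𝔞⁻¹(𝔠⁻¹Λ) = (𝔞𝔠)⁻¹Λ`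
  have hLcm : IsCMLattice ι Lc.lattice := hLc ▸ isCMLattice_idealInvLattice hL 𝔠
  have hca : Lca.lattice = Lac.lattice := by
    rw [hLca, hLc, idealInvLattice_idealInvLattice, hLac]
  have hU' : L.IsLatticeReps Lca U :=
    ⟨fun x ↦ by rw [hca]; exact hU.mem_iff x, hU.zero_mem, hU.distinct⟩
  -- cardinalities `#S = #Sc = N𝔞`, `#T = N𝔠`, `#U = N𝔞·N𝔠`
  have hScard : S.card = Ideal.absNorm 𝔞 := hS.card_eq_absNorm hK ι hL h𝔞0 hLa
  have hSccard : Sc.card = Ideal.absNorm 𝔞 := hSc.card_eq_absNorm hK ι hLcm h𝔞0 hLca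
  have hTcard : T.card = Ideal.absNorm 𝔠 := hT.card_eq_absNorm hK ι hL h𝔠0 hLc
  have hUcard : U.card = Ideal.absNorm (𝔞 * 𝔠) :=
    hU.card_eq_absNorm hK ι hL (mul_ne_zero h𝔞0 h𝔠0) hLac
  have hcard : U.card = Sc.card * T.card := by rw [hUcard, hSccard, hTcard, map_mul]
  have hSSc : S.card = Sc.card := by rw [hScard, hSccard]
  -- `v` is off the poles
  have hvca : v ∉ Lca.lattice := by
    rw [hca, hLac]
    exact hv.notMem_idealInvLattice_of_isCoprime h𝔪 (IsCoprime.mul_left h𝔞 h𝔠)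
  -- the analytic identity and the `Δ`-prefactors
  have key := PeriodPair.ellipticTheta_mul_pow_eq hT hSc hU' hcard hvca
  have hn1 : 1 ≤ Sc.card := Finset.card_pos.mpr ⟨0, hSc.zero_mem⟩
  obtain ⟨n', hn'⟩ := Nat.exists_eq_add_of_le hn1
  have hΔac : Lac.g₂ ^ 3 - 27 * Lac.g₃ ^ 2 = Lca.g₂ ^ 3 - 27 * Lca.g₃ ^ 2 := by
    rw [PeriodPair.g₂_eq_of_lattice_eq hca.symm, PeriodPair.g₃_eq_of_lattice_eq hca.symm]
  rw [PeriodPair.deShalitTheta_def, PeriodPair.deShalitTheta_def, PeriodPair.deShalitTheta_def,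
    PeriodPair.deltaRatio_def, PeriodPair.deltaRatio_def, PeriodPair.deltaRatio_def, hSSc, hΔac,
    mul_pow, mul_mul_mul_comm, key, hn', Nat.add_sub_cancel_left]
  set Δ : ℂ := L.g₂ ^ 3 - 27 * L.g₃ ^ 2 with hΔ
  set Δc : ℂ := Lc.g₂ ^ 3 - 27 * Lc.g₃ ^ 2 with hΔc
  set Δca : ℂ := Lca.g₂ ^ 3 - 27 * Lca.g₃ ^ 2 with hΔca
  have h1 : Δ ≠ 0 := L.discr_ne_zero
  have h2 : Δc ≠ 0 := Lc.discr_ne_zero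
  have h3 : Δca ≠ 0 := Lca.discr_ne_zero
  have hxy : (Δ / Δc) ^ n' * (Δc / Δ) ^ n' = 1 := by
    rw [← mul_pow, div_mul_div_comm, mul_comm Δ Δc, div_self (mul_ne_zero h2 h1), one_pow]
  calc Δc / Δca * (Δ / Δc) ^ (1 + n') * ((Δc / Δ) ^ n' * L.ellipticTheta U v)
      = Δc / Δca * (Δ / Δc) * ((Δ / Δc) ^ n' * (Δc / Δ) ^ n') * L.ellipticTheta U v := by
        rw [pow_add, pow_one]; ring
    _ = Δ / Δca * L.ellipticTheta U v := by
        rw [hxy, mul_one, div_mul_div_comm, mul_comm Δc Δ, ← div_mul_div_comm, div_self h2, mul_one]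

/-- **The named fact `DeShalit1987.prop24_ii_galoisAction` REDUCES TO ITS GALOIS CLAUSE (a).** If, in the binders of the
fact, the Artin symbol `σ_𝔠 = (𝔠, K(𝔪)/K)` carries every `x ∈ K(𝔪)` with `ι̂ x = Θ(v; L, 𝔞)` to an element with
`ι̂(σ_𝔠 x) = Θ(v; 𝔠⁻¹L, 𝔞)` (clause (a): de Shalit II.2.4 (ii) first equality, Shimura reciprocity — the PRINT content),
then the whole fact holds, clause (b) being `DeShalit1987.prop24_ii_clause_b`. (So the tree's trust in this print is exactly
its Galois half; a typer may re-cut the `def` accordingly.) [cite: deShalit1987, II.2.4 Proposition (ii)] -/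
theorem DeShalit1987.prop24_ii_galoisAction_of_clause_a
    (ha : ∀ (K : Type) [Field K] [NumberField K], IsImaginaryQuadratic K → ∀ (ι : K →+* ℂ)
      (L La Lc Lca : PeriodPair) (S Sc : Finset ℂ) (𝔪 𝔞 𝔠 : Ideal (𝓞 K)) (v : ℂ),
      IsCMLattice ι L.lattice → 𝔪 ≠ ⊥ → 𝔪 ≠ ⊤ → IsPrimitiveDivisionPoint ι 𝔪 L.lattice v →
      𝔞 ≠ ⊥ → IsCoprime 𝔞 𝔪 → 𝔠 ≠ ⊥ → IsCoprime 𝔠 𝔪 →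
      La.lattice = idealInvLattice ι 𝔞 L.lattice → L.IsLatticeReps La S →
      Lc.lattice = idealInvLattice ι 𝔠 L.lattice →
      Lca.lattice = idealInvLattice ι 𝔞 Lc.lattice → Lc.IsLatticeReps Lca Sc →
      ∀ x : rayClassField K 𝔪, algClosureEmb ι x = L.deShalitTheta La S v →
        algClosureEmb ι (artinSymbol (galFrob K (rayClassField K 𝔪)) 𝔠 x) = Lc.deShalitTheta Lca Sc v) :
    DeShalit1987.prop24_ii_galoisAction := by
  intro K _ _ hK ι L La Lc Lca Lac S Sc T U 𝔪 𝔞 𝔠 v hL h𝔪0 h𝔪1 hv h𝔞0 h𝔞 h𝔠0 h𝔠 hLa hS hLc hT hLca hSc hLac hU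
  exact ⟨ha K hK ι L La Lc Lca S Sc 𝔪 𝔞 𝔠 v hL h𝔪0 h𝔪1 hv h𝔞0 h𝔞 h𝔠0 h𝔠 hLa hS hLc hLca hSc,
    DeShalit1987.prop24_ii_clause_b hK ι hL h𝔪1 hv h𝔞0 h𝔞 h𝔠0 h𝔠 hLa hS hLc hT hLca hSc hLac hU⟩

end Literature.NumberTheory.ComplexMultiplication.EllipticUnits

/-! ## §4. Index multiplicativity: the hypothesis `#U = #Sc · #T` of §2 discharged (appended 2026-08-30) -/

namespace PeriodPair

/-- **Representatives count the relative index**: `#S = [Λ′ : Λ]` (the tree's `IsLatticeReps.natCard_quotient` with the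
subgroup `Λ ∩ Λ′ ≤ Λ′`, i.e. Mathlib's `AddSubgroup.relIndex`). [cite: deShalit1987, II.2.3 (10)] -/
theorem IsLatticeReps.card_eq_relIndex {L La : PeriodPair} {S : Finset ℂ} (hS : L.IsLatticeReps La S) :
    S.card = L.lattice.toAddSubgroup.relIndex La.lattice.toAddSubgroup := by
  rw [AddSubgroup.relIndex, AddSubgroup.index]
  exact (hS.natCard_quotient _ fun x ↦ AddSubgroup.mem_addSubgroupOf).symm

/-- **Index multiplicativity in a tower `Λ ≤ Λ_c ≤ Λ_{ca}`**: `#U = #Sc · #T` for representatives `T` of `Λ_c/Λ`, `Sc` of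
`Λ_{ca}/Λ_c`, `U` of `Λ_{ca}/Λ` (`[Λ_{ca} : Λ] = [Λ_{ca} : Λ_c][Λ_c : Λ]`, Mathlib `AddSubgroup.relIndex_mul_relIndex`).
[cite: deShalit1987, II.2.3 (10)] [cite: Silverman1994, Ch. II §1.1 Cor. 1.5] -/
theorem IsLatticeReps.card_eq_card_mul_card {L Lc Lca : PeriodPair} {T Sc U : Finset ℂ} (hT : L.IsLatticeReps Lc T)
    (hSc : Lc.IsLatticeReps Lca Sc) (hU : L.IsLatticeReps Lca U) : U.card = Sc.card * T.card := by
  rw [hT.card_eq_relIndex, hSc.card_eq_relIndex, hU.card_eq_relIndex, mul_comm]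
  exact (AddSubgroup.relIndex_mul_relIndex (H := L.lattice.toAddSubgroup) (K := Lc.lattice.toAddSubgroup)
    (L := Lca.lattice.toAddSubgroup) (fun _ hx ↦ hT.le hx) (fun _ hx ↦ hSc.le hx)).symm

/-- ★ **Composition formula for Rubin's `Θ`, hypothesis-free form** of `ellipticTheta_mul_pow_eq` (the index condition
`#U = #Sc · #T` is automatic, `IsLatticeReps.card_eq_card_mul_card`): for period lattices `Λ ≤ Λ_c ≤ Λ_{ca}` with representatives
`T`, `Sc`, `U` and every `z ∉ Λ_{ca}`, `Θ(z; Λ_c, Sc)·Θ(z; Λ, T)^{#Sc} = (Δ(Λ_c)/Δ(Λ))^{#Sc−1}·Θ(z; Λ, U)`.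
[cite: deShalit1987, II.2.4 Proposition (ii)] [cite: Rubin1999, §7.4 Thm. 7.13] -/
theorem ellipticTheta_mul_pow_eq' {L Lc Lca : PeriodPair} {T Sc U : Finset ℂ} (hT : L.IsLatticeReps Lc T)
    (hSc : Lc.IsLatticeReps Lca Sc) (hU : L.IsLatticeReps Lca U) {z : ℂ} (hz : z ∉ Lca.lattice) :
    Lc.ellipticTheta Sc z * L.ellipticTheta T z ^ Sc.card =
      ((Lc.g₂ ^ 3 - 27 * Lc.g₃ ^ 2) / (L.g₂ ^ 3 - 27 * L.g₃ ^ 2)) ^ (Sc.card - 1) * L.ellipticTheta U z :=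
  ellipticTheta_mul_pow_eq hT hSc hU (hT.card_eq_card_mul_card hSc hU) hz

end PeriodPair

end
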